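import Summits.MatrixMultiplication.OmegaCensus.ThreeSetLineModFour
import Summits.MatrixMultiplication.OmegaCensus.DominoZpZpScaled
import HarnessLib

/-!
# The bit-sliced MOD-4 FILTER for the three-set line identity, I: definitions (pure `ℕ`, `Bool`)

ω-census `pub-omega`, family (b3), seat pub-omega-group gen 42.  Framing: lottery ticket; floor = certified bounds/negative
ranges.  VALUE: a kernel TOOL for the three-set cube cells `(4, d, e)@p²` (`ThreeSetZpCells4Core`); NOT progress on ω.

The residue test of `ThreeSetLineModFour` (`LineMod.no_line_identity3_of_mod_cert`, modulus `m = 4`) is pure `ℤ/4`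
arithmetic, so it is evaluated BIT-SLICED over a whole block of `X`-data at once: a SLICE is a numeral whose bit `k` belongs to
datum `k`; a `ℤ/4`-digit for all data is a pair `(lo, hi)` of slices (`S2`); a vector over `ℤ_p` is a list of `p` such pairs.
Every gate of the computation is ONE `Nat.land / Nat.xor / Nat.lor` on slices (GMP in the kernel), whatever the number of data.
* gadgets `add2 / neg2 / sub2 / mul2 / smul2` (digit arithmetic mod 4), `conv2` (cyclic convolution), `psl / qsl` (the symbols
  `P`, `Q` of `lineMat3` from the sliced data), `hatv`, `vadd / vsub / vneg / vsum`;
* the UNTRUSTED inverse: `Δ = (P+1)² − QQ̂`, `z₀ = Π_{i≥1} Frob^i(Δ mod 2)` in `𝔽₂[C_p]` (`towerF2`, schedule `sched`), one Newton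
  step `z = z₀(2 − Δz₀)`, `α = z(P+1)`, `β = −zQ` — nothing is proved about this part; the checker VERIFIES the two identities
  `α⋆(P+1) + β⋆Q̂ = δ₀`, `α⋆Q + β⋆(P̂+1) = 0` slice-wise (`ndMask`, `nzMask`);
* the hole test: `Y_s(v) = c₀ − α(v−s) − β(v+s)`, `c₀ = (K+e)(Σα + Σβ)`, digit sums by a sliced 8-bit counter (`incAt`),
  comparison with `e` (`cmpC`), `passMask = ⋁_s [Σ_v val Y_s(v) ≤ e]`;
* the data: the block `(ZpZpDomino.compsLit n j).map (pre ++ ·)` is never materialised — its two low bit-planes per coordinate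
  are GENERATED in the kernel by `genPlanes` (same recursion as `compsLit`, shifts and ors of numerals);
* `blockChk p K d e W pre n j sched`: parameter sanity + `(badMask ||| passMask) &&& ones = 0` (no survivor in the block).
Semantics and soundness: `ThreeSetLineModFourSliceLemmas` (digits, vectors), `…SliceMasks` (masks, counters), `…SlicePlanes`
(the generated planes represent `compsLit`), `…SliceSound` (`blockChk_sound`).  Python twin (exact mirror):
HOME/pub-omega-group-g42/code/slicetwin.py.  Measured (farm): ≈ 10⁵ slice operations per block independently of its size;
blocks of 1.7·10⁵ / 4.8·10⁵ / 1.18·10⁶ data of `(4,7,10)@841` in 13 / 15 / 23 s of kernel time.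
-/

namespace Summit.MatrixMultiplication.OmegaCensus

namespace LineMod

/-! ## Sliced `ℤ/4` digits -/

/-- A sliced `ℤ/4`-digit: `(lo, hi)` bit-planes; datum `k` holds `lo.testBit k + 2·hi.testBit k`. [folklore] -/
abbrev S2 := ℕ × ℕ

/-- Sliced addition mod 4. [folklore] -/
def add2 (a b : S2) : S2 := (a.1 ^^^ b.1, a.2 ^^^ b.2 ^^^ (a.1 &&& b.1))

/-- Sliced negation mod 4. [folklore] -/
def neg2 (a : S2) : S2 := (a.1, a.2 ^^^ a.1)

/-- Sliced subtraction mod 4. [folklore] -/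
def sub2 (a b : S2) : S2 := add2 a (neg2 b)

/-- Sliced multiplication mod 4. [folklore] -/
def mul2 (a b : S2) : S2 := (a.1 &&& b.1, (a.1 &&& b.2) ^^^ (a.2 &&& b.1))

/-- Sliced multiplication by the constant `c` (mod 4). [folklore] -/
def smul2 (c : ℕ) (a : S2) : S2 :=
  if c % 4 = 0 then (0, 0) else if c % 4 = 1 then a else if c % 4 = 2 then (0, a.1) else neg2 a

/-- Digit `i` of a sliced vector (`(0,0)` beyond the end). [folklore] -/
def vget (f : List S2) (i : ℕ) : S2 := f.getD i (0, 0)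

/-- A strict digest of a sliced vector (forces every slice; used only to sequence the evaluation). [folklore] -/
def xfold (f : List S2) : ℕ := f.foldl (fun acc a => acc ^^^ a.1 ^^^ a.2) 0

/-! ## Sliced vectors over `ℤ_p` -/

/-- The sliced data mod 4 from the bit-planes: digit `i` = `(plane i 0, plane i 1)`. [folklore] -/
def sdigits (p : ℕ) (PL : List (List ℕ)) : List S2 :=
  (List.range p).map fun i => ((PL.getD i []).getD 0 0, (PL.getD i []).getD 1 0)

/-- Inner sum of `psl` over `v < n` (structural, strict). [folklore] -/
def pslSum (p : ℕ) (W : List ℕ) (X : List S2) (t : ℕ) : ℕ → S2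
  | 0 => (0, 0)
  | v + 1 => add2 (pslSum p W X t v) (smul2 (W.getD v 0) (add2 (vget X ((t + v) % p)) (vget X ((v + p - t) % p))))

/-- The sliced circulant symbol `P(t) = Σ_v W(v)·(X(t+v) + X(v−t))`. [folklore] -/
def psl (p : ℕ) (W : List ℕ) (X : List S2) : List S2 := (List.range p).map fun t => pslSum p W X t p

/-- Inner sum of `qsl`. [folklore] -/
def qslSum (p : ℕ) (W : List ℕ) (X : List S2) (t : ℕ) : ℕ → S2
  | 0 => (0, 0)
  | v + 1 => add2 (qslSum p W X t v) (smul2 (W.getD v 0) (vget X ((t + p - v) % p)))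

/-- The sliced Hankel symbol `Q(t) = Σ_v W(v)·X(t−v)`. [folklore] -/
def qsl (p : ℕ) (W : List ℕ) (X : List S2) : List S2 := (List.range p).map fun t => qslSum p W X t p

/-- `P + 1` (the all-ones slice `ones` is the constant digit `1`). [folklore] -/
def ppl (p ones : ℕ) (P : List S2) : List S2 := (List.range p).map fun t => add2 (vget P t) (ones, 0)

/-- Inner sum of the sliced convolution. [folklore] -/
def convSum (p : ℕ) (f g : List S2) (t : ℕ) : ℕ → S2
  | 0 => (0, 0)
  | a + 1 => add2 (convSum p f g t a) (mul2 (vget f a) (vget g ((t + p - a) % p)))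

/-- Sliced cyclic convolution `(f ⋆ g)(t) = Σ_a f(a) g(t−a)`. [folklore] -/
def conv2 (p : ℕ) (f g : List S2) : List S2 := (List.range p).map fun t => convSum p f g t p

/-- Reflection `ĝ(t) = g(−t)`. [folklore] -/
def hatv (p : ℕ) (g : List S2) : List S2 := (List.range p).map fun t => vget g ((p - t) % p)

/-- Digit-wise sum. [folklore] -/
def vadd (p : ℕ) (f g : List S2) : List S2 := (List.range p).map fun t => add2 (vget f t) (vget g t)

/-- Digit-wise difference. [folklore] -/
def vsub (p : ℕ) (f g : List S2) : List S2 := (List.range p).map fun t => sub2 (vget f t) (vget g t)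

/-- Digit-wise negation. [folklore] -/
def vneg (p : ℕ) (f : List S2) : List S2 := (List.range p).map fun t => neg2 (vget f t)

/-- Sum of the digits `t < n`. [folklore] -/
def vsumTo (f : List S2) : ℕ → S2
  | 0 => (0, 0)
  | t + 1 => add2 (vsumTo f t) (vget f t)

/-! ## The untrusted inverse: Frobenius tower in `𝔽₂[C_p]` and one Newton step -/

/-- Frobenius `σ₂` on `𝔽₂[C_p]` (lo-planes): `(σ₂ d)(t) = d(t/2)`. [folklore] -/
def frob (p : ℕ) (d : List ℕ) : List ℕ := (List.range p).map fun t => d.getD (t * ((p + 1) / 2) % p) 0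

/-- `σ₂^k`. [folklore] -/
def frobk (p : ℕ) : ℕ → List ℕ → List ℕ
  | 0, d => d
  | k + 1, d => frob p (frobk p k d)

/-- Inner sum of the `𝔽₂` convolution. [folklore] -/
def convF2Sum (p : ℕ) (f g : List ℕ) (t : ℕ) : ℕ → ℕ
  | 0 => 0
  | a + 1 => convF2Sum p f g t a ^^^ (f.getD a 0 &&& g.getD ((t + p - a) % p) 0)

/-- Sliced product in `𝔽₂[C_p]`. [folklore] -/
def convF2 (p : ℕ) (f g : List ℕ) : List ℕ := (List.range p).map fun t => convF2Sum p f g t p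

/-- The tower `(V_k, k)`, `V_k = Π_{1≤i≤k} σ₂^i(d)`: schedule `true ↦ 2k`, `false ↦ k+1` (head applied last). [folklore] -/
def towerF2 (p : ℕ) (d : List ℕ) : List Bool → List ℕ × ℕ
  | [] => (frob p d, 1)
  | true :: st =>
    let r := towerF2 p d st
    (convF2 p r.1 (frobk p r.2 r.1), 2 * r.2)
  | false :: st =>
    let r := towerF2 p d st
    (convF2 p (frob p d) (frob p r.1), r.2 + 1)

/-- Lift an `𝔽₂[C_p]` element to sliced `ℤ/4` digits. [folklore] -/
def liftF2 (p : ℕ) (d : List ℕ) : List S2 := (List.range p).map fun t => (d.getD t 0, 0)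

/-- The lo-planes of a sliced vector (reduction mod 2). [folklore] -/
def loPlanes (p : ℕ) (f : List S2) : List ℕ := (List.range p).map fun t => (vget f t).1

/-- `2·δ₀ − t` (the Newton correction factor). [folklore] -/
def newtonU (p ones : ℕ) (t : List S2) : List S2 :=
  (List.range p).map fun i => sub2 (if i = 0 then (0, ones) else (0, 0)) (vget t i)

/-! ## Sliced counters and the comparison with a constant -/

/-- Add a one-bit plane to a fixed-width little-endian sliced counter (final carry dropped). [folklore] -/
def incFrom : List ℕ → ℕ → List ℕ
  | [], _ => []
  | c0 :: cs, b => (c0 ^^^ b) :: incFrom cs (c0 &&& b)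

/-- Add the plane `b` at position `i` (value `2^i`). [folklore] -/
def incAt : List ℕ → ℕ → ℕ → List ℕ
  | [], _, _ => []
  | c0 :: cs, 0, b => incFrom (c0 :: cs) b
  | c0 :: cs, i + 1, b => c0 :: incAt cs i b

/-- `(lt, eq)` masks of the comparison of a sliced counter with the constant `e`. [folklore] -/
def cmpC (ones : ℕ) : List ℕ → ℕ → ℕ × ℕ
  | [], e => (if 0 < e then ones else 0, if e = 0 then ones else 0)
  | c0 :: cs, e =>
    let r := cmpC ones cs (e / 2)
    if e % 2 = 1 then (r.1 ||| (r.2 &&& (c0 ^^^ ones)), r.2 &&& c0) else (r.1, r.2 &&& (c0 ^^^ ones))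

/-- Digit sum `Σ_{v<n} val Y(v)` of a sliced vector into a counter of width `8`. [folklore] -/
def digitSum (Y : List S2) : ℕ → List ℕ
  | 0 => [0, 0, 0, 0, 0, 0, 0, 0]
  | v + 1 => incAt (incAt (digitSum Y v) 0 (vget Y v).1) 1 (vget Y v).2

/-- The residue vector of hole `s`: `Y_s(v) = c₀ + α'(v−s) + β'(v+s)` (`α' = −α`, `β' = −β`). [folklore] -/
def holeVec (p : ℕ) (c0 : S2) (α' β' : List S2) (s : ℕ) : List S2 :=
  (List.range p).map fun v => add2 c0 (add2 (vget α' ((v + p - s) % p)) (vget β' ((v + s) % p)))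

/-- Mask of the data for which hole `s` PASSES the digit-sum test (`Σ_v val Y_s(v) ≤ e`). [folklore] -/
def holePass (p ones e : ℕ) (c0 : S2) (α' β' : List S2) (s : ℕ) : ℕ :=
  let r := cmpC ones (digitSum (holeVec p c0 α' β' s) p) e
  r.1 ||| r.2

/-- `⋁_{s<n}` of the hole masks (strict in each step). [folklore] -/
def passMask (p ones e : ℕ) (c0 : S2) (α' β' : List S2) : ℕ → ℕ
  | 0 => 0
  | s + 1 =>
    match holePass p ones e c0 α' β' s with
    | 0 => passMask p ones e c0 α' β' s
    | m + 1 => passMask p ones e c0 α' β' s ||| (m + 1)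

/-- Mask of the data where a vector is NOT identically `0` on digits `t < n`. [folklore] -/
def nzMask (f : List S2) : ℕ → ℕ
  | 0 => 0
  | t + 1 => nzMask f t ||| (vget f t).1 ||| (vget f t).2

/-- Mask of the data where a vector is NOT `δ₀` (digits `t < p`). [folklore] -/
def ndMask (p ones : ℕ) (f : List S2) : ℕ :=
  nzMask ((List.range p).map fun t => if t = 0 then add2 (vget f 0) (ones, ones) else vget f t) p

/-! ## The filter on one block of sliced data -/

/-- Sequencing helper: force a sliced vector, then continue. [folklore] -/
def seqV {γ : Type} (f : List S2) (k : Unit → γ) : γ := match xfold f with | 0 => k () | _ + 1 => k ()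

/-- **The sliced mod-4 filter.**  Input: `p`, the all-ones slice `ones = 2^L − 1`, `K`, `e`, the killer `W`, the sliced data `X`,
the tower schedule; output: the SURVIVOR mask (certificate failure or some hole passing), restricted to `ones`. [folklore] -/
def survMask (p ones K e : ℕ) (W : List ℕ) (X : List S2) (sched : List Bool) : ℕ :=
  let P := psl p W X
  let Q := qsl p W X
  seqV P fun _ => seqV Q fun _ =>
  let Pp := ppl p ones P
  let D := vsub p (conv2 p Pp Pp) (conv2 p Q (hatv p Q))
  seqV D fun _ =>
  let z0 := liftF2 p (towerF2 p (loPlanes p D) sched).1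
  seqV z0 fun _ =>
  let T := conv2 p D z0
  seqV T fun _ =>
  let z := conv2 p z0 (newtonU p ones T)
  seqV z fun _ =>
  let α := conv2 p z Pp
  let β := vneg p (conv2 p z Q)
  seqV α fun _ => seqV β fun _ =>
  let C1 := vadd p (conv2 p α Pp) (conv2 p β (hatv p Q))
  let C2 := vadd p (conv2 p α Q) (conv2 p β (hatv p Pp))
  seqV C1 fun _ => seqV C2 fun _ =>
  let bad := ndMask p ones C1 ||| nzMask C2 p
  let c0 := smul2 (K + e) (vsumTo (vadd p α β) p)
  let α' := vneg p α
  let β' := vneg p β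
  seqV α' fun _ => seqV β' fun _ =>
  (bad ||| passMask p ones e c0 α' β' p) &&& ones

/-! ## The data: bit-planes of a block of `compsLit` generated in the kernel -/

/-- `2^L − 1`. [folklore] -/
def onesOf (L : ℕ) : ℕ := 2 ^ L - 1

/-- Or the planes `src` shifted by `off` into `acc` (coordinate-wise, two planes each). [folklore] -/
def orShift (acc src : List (List ℕ)) (off : ℕ) : List (List ℕ) :=
  List.zipWith (fun a s => [a.getD 0 0 ||| (s.getD 0 0 <<< off), a.getD 1 0 ||| (s.getD 1 0 <<< off)]) acc src

/-- The two low bit-planes of the constant `c` on `L` data, shifted by `off`. [folklore] -/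
def cstPlanes (c L off : ℕ) : List ℕ :=
  [if c % 2 = 1 then onesOf L <<< off else 0, if c / 2 % 2 = 1 then onesOf L <<< off else 0]

/-- Forcing helper: evaluate the argument to a numeral before the call (kernel strictness; `= sub m`). [folklore] -/
def forceSub {α : Type} (sub : ℕ → α) (m : ℕ) : α := match m with | 0 => sub 0 | i + 1 => sub (i + 1)

/-- Forcing helper: evaluate the first component to a numeral (`= (L, A)`). [folklore] -/
def forcePair {β : Type} (L : ℕ) (A : β) : ℕ × β := match L with | 0 => (0, A) | L' + 1 => (L' + 1, A)

/-- One `compsLit` recursion step, folded over the leading entry `c = 0 … j` (children in `compsLit` order):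
`sub j'` is `(length, planes)` of `compsLit n j'`; result for the first `c` children of `compsLit (n+1) j`. [folklore] -/
def genFold (sub : ℕ → ℕ × List (List ℕ)) (n j : ℕ) : ℕ → ℕ × List (List ℕ)
  | 0 => (0, List.replicate (n + 1) [0, 0])
  | c + 1 =>
    let acc := genFold sub n j c
    let r := forceSub sub (j - c)
    forcePair (acc.1 + r.1) (orShift acc.2 (cstPlanes c r.1 0 :: r.2) acc.1)

/-- **Bit-planes of `compsLit n j`**: `(L, PL)` with `L = |compsLit n j|` and `PL[i] = [plane of bit 0, plane of bit 1]` of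
coordinate `i < n` (datum `k` = the `k`-th list of `compsLit n j`). [folklore] -/
def genPlanes : ℕ → ℕ → ℕ × List (List ℕ)
  | 0, j => (if j = 0 then 1 else 0, [])
  | n + 1, j => genFold (genPlanes n) n j (j + 1)

/-- The planes of the block `(compsLit n j).map (pre ++ ·)`: constant planes for the prefix, generated planes after. [folklore] -/
def blockPlanes (pre : List ℕ) (n j : ℕ) : ℕ × List (List ℕ) :=
  let g := genPlanes n j
  (g.1, pre.map (fun c => cstPlanes c g.1 0) ++ g.2)

/-- **The block checker.**  `true` ⇒ no datum of `(compsLit n j).map (pre ++ ·)` admits a solution of the three-set line identity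
with the killer `W`, constant `K` (`ThreeSetLineModFourSliceSound.blockChk_sound`). [folklore] -/
def blockChk (p K d e : ℕ) (W pre : List ℕ) (n j : ℕ) (sched : List Bool) : Bool :=
  let B := blockPlanes pre n j
  let ones := onesOf B.1
  (0 < p : Bool) && (3 * p < 256 : Bool) && (W.length == p) && (pre.length + n == p) && (pre.sum + j == d) &&
  (0 < W.sum * d : Bool) &&
  (3 * (W.sum * d) * e + 1 == p * K) &&
  (survMask p ones K e W (sdigits p B.2) sched == 0)

end LineMod

end Summit.MatrixMultiplication.OmegaCensus
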